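import Summits.AtomisticToContinuum.HydrodynamicLimit.Theorems.EnskogAdjointDualityAdjointEnskogTestFamilyRDualitySlicePrep
import HarnessLib

/-!
# K2R refutation, stub `dualitySlice`: the swap formula for the critical and the dipole weight

Route `EnskogAdjointDuality` of `AtomisticToContinuum/HydrodynamicLimit`, crux `AdjointEnskogTestFamilyR`
(stmt-AtomisticToContinuum-11592, "K2R"), line `refutation`: closes the registered stub
`stub_dualitySlice` (Prop `DualitySlice` of the refutation skeleton). For `R ≥ 1`, a unit impact
direction `ν`, a measurable `F` with `|F(U)| ≤ C_F(1+|U|²)` and the two weights of the dual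
hyper-velocity balance, `Θ₀^R(v) = (1+|v|²)⁻³e^{-|v|²/R}` (critical, radial) and
`Θ₁^R(v) = |v|(1+|v|²)⁻⁴e^{-|v|²/R} v₀` (dipole), the generic duality of the preparation file
(`k2r_ref_duality`) specialises to the EXPLICIT kernels
`I₀(U,ν) = ½ e^{-(|U|²-a²)/2} h(a) Θ̄₀(a²)`, `I₁(U,ν) = ν₀ a · ½ e^{-(|U|²-a²)/2} h(a) Θ̄₁(a²)`,
`a = U·ν`, `Θ̄(x) = ∫_x^∞ ϑ` (`k2r_ref_integral_radial_fin_two`; the transverse dipole part is odd and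
integrates to zero, `k2r_ref_fibre_integral1`), with the crude bounds `0 ≤ h(a) ≤ 2(1+|a|)`,
`0 ≤ Θ̄(x) ≤ 1/2` (`x ≥ 0`) behind `0 ≤ I₀ ≤ (1+|a|)e^{…}`, `|I₁| ≤ (1+|a|)²e^{…}`.
* `k2r_ref_integral_Ioi_inv_cube`, `k2r_ref_tail_bounds`, `k2r_ref_h_bounds` — 1-D bounds;
* `k2r_ref_weight0`, `k2r_ref_weight1` — measurability and `(1+|v|²)²Θ ∈ L¹` (Gaussian domination);
* `stub_dualitySlice` — the registered statement.
References: C. Cercignani, R. Illner, M. Pulvirenti, *The Mathematical Theory of Dilute Gases* (1994),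
§3.1 (1.7)–(1.9) [CIP1994].
-/

noncomputable section

namespace Summit.AtomisticToContinuum.HydrodynamicLimit.Theorems.EnskogAdjointDuality

open MeasureTheory Set Filter Topology
open scoped InnerProductSpace Real
open Literature.MathematicalPhysics.KineticTheory Literature.Analysis.FluidPDE Literature.Analysis.FunctionSpaces

/-! ## One-dimensional facts -/

/-- `∫_x^∞ (1+E)⁻³ dE = (1+x)⁻²/2` for `x ≥ 0`, with integrability. [folklore] -/
theorem k2r_ref_integral_Ioi_inv_cube {x : ℝ} (hx : 0 ≤ x) :
    IntegrableOn (fun E : ℝ => ((1 + E) ^ 3)⁻¹) (Ioi x) ∧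
      ∫ E in Ioi x, ((1 + E) ^ 3)⁻¹ = ((1 + x) ^ 2)⁻¹ / 2 := by
  set g : ℝ → ℝ := fun E => -((1 + E) ^ 2)⁻¹ / 2 with hg
  have hderiv : ∀ E ∈ Ioi x, HasDerivAt g (((1 + E) ^ 3)⁻¹) E := by
    intro E hE
    have hE0 : 0 < 1 + E := by have : x < E := hE; linarith
    have hE1 : (1 + E) ≠ 0 := hE0.ne'
    have h1 : HasDerivAt (fun E : ℝ => (1 + E) ^ 2) (2 * (1 + E)) E := by
      simpa using ((hasDerivAt_id E).const_add 1).fun_pow 2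
    have h2 := (h1.inv (pow_ne_zero 2 hE1)).neg.div_const 2
    have h3 : -(-(2 * (1 + E)) / ((1 + E) ^ 2) ^ 2) / 2 = ((1 + E) ^ 3)⁻¹ := by
      field_simp
    rw [h3] at h2
    exact h2
  have hcont : ContinuousWithinAt g (Ici x) x := by
    have hx1 : (1 + x) ≠ 0 := by positivity
    refine ContinuousAt.continuousWithinAt ?_
    have : ContinuousAt (fun E : ℝ => (1 + E) ^ 2) x := by fun_prop
    exact ((this.inv₀ (pow_ne_zero 2 hx1)).neg.div_const 2)
  have htend : Tendsto g atTop (𝓝 0) := by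
    have h1 : Tendsto (fun E : ℝ => (1 + E) ^ 2) atTop atTop :=
      (tendsto_pow_atTop two_ne_zero).comp (tendsto_atTop_add_const_left _ 1 tendsto_id)
    have h3 := h1.inv_tendsto_atTop.neg.div_const 2
    simp only [neg_zero, zero_div] at h3
    refine h3.congr (fun E => ?_)
    simp [hg, neg_div]
  have hpos : ∀ E ∈ Ioi x, 0 ≤ ((1 + E) ^ 3)⁻¹ := fun E hE => by
    have hE0 : 0 < 1 + E := by have : x < E := hE; linarith
    exact inv_nonneg.2 (pow_nonneg hE0.le 3)
  have hint := integrableOn_Ioi_deriv_of_nonneg hcont hderiv hpos htend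
  refine ⟨hint, ?_⟩
  rw [integral_Ioi_of_hasDerivAt_of_tendsto hcont hderiv hint htend]
  simp only [hg]
  ring

/-- The critical weight `ϑ₀^R(E) = (1+E)⁻³e^{-E/R}`: `0 ≤ ϑ₀^R(E) ≤ (1+E)⁻³` for `E ≥ 0`. [folklore] -/
theorem k2r_ref_th0_bounds {R E : ℝ} (hR : 0 < R) (hE : 0 ≤ E) :
    0 ≤ ((1 + E) ^ 3)⁻¹ * Real.exp (-E / R) ∧
      ((1 + E) ^ 3)⁻¹ * Real.exp (-E / R) ≤ ((1 + E) ^ 3)⁻¹ := by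
  have h1 : 0 ≤ ((1 + E) ^ 3)⁻¹ := by positivity
  have h2 : Real.exp (-E / R) ≤ 1 :=
    Real.exp_le_one_iff.2 (div_nonpos_of_nonpos_of_nonneg (neg_nonpos.2 hE) hR.le)
  exact ⟨mul_nonneg h1 (Real.exp_pos _).le, mul_le_of_le_one_right h1 h2⟩

/-- The dipole weight `ϑ₁^R(E) = √E(1+E)⁻⁴e^{-E/R}`: `0 ≤ ϑ₁^R(E) ≤ (1+E)⁻³` for `E ≥ 0`. [folklore] -/
theorem k2r_ref_th1_bounds {R E : ℝ} (hR : 0 < R) (hE : 0 ≤ E) :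
    0 ≤ Real.sqrt E * ((1 + E) ^ 4)⁻¹ * Real.exp (-E / R) ∧
      Real.sqrt E * ((1 + E) ^ 4)⁻¹ * Real.exp (-E / R) ≤ ((1 + E) ^ 3)⁻¹ := by
  have h1 : 0 ≤ ((1 + E) ^ 4)⁻¹ := by positivity
  have h2 : Real.exp (-E / R) ≤ 1 :=
    Real.exp_le_one_iff.2 (div_nonpos_of_nonpos_of_nonneg (neg_nonpos.2 hE) hR.le)
  have hsq : Real.sqrt E ≤ 1 + E := by
    rw [Real.sqrt_le_left (by positivity)]
    nlinarith
  refine ⟨by positivity, ?_⟩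
  calc Real.sqrt E * ((1 + E) ^ 4)⁻¹ * Real.exp (-E / R)
      ≤ (1 + E) * ((1 + E) ^ 4)⁻¹ * 1 := by gcongr
    _ = ((1 + E) ^ 3)⁻¹ := by
        have : (1 + E) ≠ 0 := by positivity
        field_simp

/-- Tails of a weight dominated by `(1+E)⁻³` on `[0, ∞)`: `0 ≤ ∫_x^∞ ϑ ≤ 1/2` for `x ≥ 0`. [folklore] -/
theorem k2r_ref_tail_bounds {θ : ℝ → ℝ} (hθ : ∀ E, 0 ≤ E → 0 ≤ θ E ∧ θ E ≤ ((1 + E) ^ 3)⁻¹)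
    {x : ℝ} (hx : 0 ≤ x) :
    0 ≤ ∫ E in Ioi x, θ E ∧ ∫ E in Ioi x, θ E ≤ 1 / 2 := by
  have hIoi : ∀ E ∈ Ioi x, 0 ≤ E := fun E hE => hx.trans (le_of_lt hE)
  refine ⟨setIntegral_nonneg measurableSet_Ioi fun E hE => (hθ E (hIoi E hE)).1, ?_⟩
  obtain ⟨hint, hval⟩ := k2r_ref_integral_Ioi_inv_cube hx
  calc ∫ E in Ioi x, θ E ≤ ∫ E in Ioi x, ((1 + E) ^ 3)⁻¹ := by
        refine integral_mono_of_nonneg ?_ hint ?_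
        · exact (ae_restrict_iff' measurableSet_Ioi).2
            (Eventually.of_forall fun E hE => (hθ E (hIoi E hE)).1)
        · exact (ae_restrict_iff' measurableSet_Ioi).2
            (Eventually.of_forall fun E hE => (hθ E (hIoi E hE)).2)
    _ = ((1 + x) ^ 2)⁻¹ / 2 := hval
    _ ≤ 1 / 2 := by
        have : ((1 + x) ^ 2)⁻¹ ≤ 1 := inv_le_one_of_one_le₀ (by nlinarith)
        linarith

/-- The half-Gaussian first moment `h(a) = ∫ (a-b)₊ φ₁(b) db` satisfies `0 ≤ h(a) ≤ 2(1+|a|)`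
(`(a-b)₊ ≤ |a| + |b|`, `|b| ≤ e^{b²/4}`, `∫ e^{-b²/4} = √(4π) ≤ 2√(2π)`). [folklore] -/
theorem k2r_ref_h_bounds (a : ℝ) :
    0 ≤ ∫ b, max (a - b) 0 * (Real.exp (-b ^ 2 / 2) / Real.sqrt (2 * π)) ∧
      ∫ b, max (a - b) 0 * (Real.exp (-b ^ 2 / 2) / Real.sqrt (2 * π)) ≤ 2 * (1 + |a|) := by
  have hsq : 0 < Real.sqrt (2 * π) := Real.sqrt_pos.2 (by positivity)
  have hnn : ∀ b, 0 ≤ max (a - b) 0 * (Real.exp (-b ^ 2 / 2) / Real.sqrt (2 * π)) :=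
    fun b => by positivity
  refine ⟨integral_nonneg hnn, ?_⟩
  -- dominating Gaussian
  set g : ℝ → ℝ := fun b => (|a| + 1) / Real.sqrt (2 * π) * Real.exp (-(1 / 4) * b ^ 2) with hg
  have hgi : Integrable g := (integrable_exp_neg_mul_sq (by norm_num : (0 : ℝ) < 1 / 4)).const_mul _
  have hle : ∀ b, max (a - b) 0 * (Real.exp (-b ^ 2 / 2) / Real.sqrt (2 * π)) ≤ g b := by
    intro b
    have hmax : max (a - b) 0 ≤ |a| + |b| :=
      max_le (by linarith [le_abs_self a, neg_abs_le b]) (by positivity)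
    have hb : |b| ≤ Real.exp (b ^ 2 / 4) := by
      have h1 : |b| ≤ 1 + b ^ 2 / 4 := by nlinarith [sq_nonneg (|b| - 2), sq_abs b, abs_nonneg b]
      have h2 : b ^ 2 / 4 + 1 ≤ Real.exp (b ^ 2 / 4) := Real.add_one_le_exp _
      linarith
    have he1 : Real.exp (-b ^ 2 / 2) ≤ Real.exp (-(1 / 4) * b ^ 2) :=
      Real.exp_le_exp.2 (by nlinarith [sq_nonneg b])
    have he2 : |b| * Real.exp (-b ^ 2 / 2) ≤ Real.exp (-(1 / 4) * b ^ 2) := by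
      calc |b| * Real.exp (-b ^ 2 / 2) ≤ Real.exp (b ^ 2 / 4) * Real.exp (-b ^ 2 / 2) := by
            gcongr
        _ = Real.exp (-(1 / 4) * b ^ 2) := by rw [← Real.exp_add]; congr 1; ring
    have key : max (a - b) 0 * Real.exp (-b ^ 2 / 2) ≤ (|a| + 1) * Real.exp (-(1 / 4) * b ^ 2) := by
      calc max (a - b) 0 * Real.exp (-b ^ 2 / 2) ≤ (|a| + |b|) * Real.exp (-b ^ 2 / 2) := by
            gcongr
        _ = |a| * Real.exp (-b ^ 2 / 2) + |b| * Real.exp (-b ^ 2 / 2) := by ring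
        _ ≤ |a| * Real.exp (-(1 / 4) * b ^ 2) + Real.exp (-(1 / 4) * b ^ 2) := by gcongr
        _ = (|a| + 1) * Real.exp (-(1 / 4) * b ^ 2) := by ring
    rw [hg, mul_div_assoc', div_le_iff₀ hsq]
    calc max (a - b) 0 * Real.exp (-b ^ 2 / 2) ≤ (|a| + 1) * Real.exp (-(1 / 4) * b ^ 2) := key
      _ = (|a| + 1) / Real.sqrt (2 * π) * Real.exp (-(1 / 4) * b ^ 2) * Real.sqrt (2 * π) := by
          field_simp
  calc ∫ b, max (a - b) 0 * (Real.exp (-b ^ 2 / 2) / Real.sqrt (2 * π))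
      ≤ ∫ b, g b := integral_mono_of_nonneg (Eventually.of_forall hnn) hgi (Eventually.of_forall hle)
    _ = (|a| + 1) / Real.sqrt (2 * π) * Real.sqrt (π / (1 / 4)) := by
        rw [hg, integral_const_mul, integral_gaussian]
    _ ≤ (|a| + 1) / Real.sqrt (2 * π) * (2 * Real.sqrt (2 * π)) := by
        gcongr
        calc Real.sqrt (π / (1 / 4)) ≤ Real.sqrt (2 ^ 2 * (2 * π)) :=
              Real.sqrt_le_sqrt (by nlinarith [Real.pi_pos])
          _ = 2 * Real.sqrt (2 * π) := by
              rw [Real.sqrt_mul (by norm_num), Real.sqrt_sq (by norm_num)]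
    _ = 2 * (1 + |a|) := by field_simp; ring

/-! ## The two weights of the refutation -/

/-- The critical weight `Θ₀^R(v) = (1+|v|²)⁻³e^{-|v|²/R}` on `ℝ³`: measurable, with
`(1+|v|²)² Θ₀^R ≤ e^{-|v|²/R} ∈ L¹`. [folklore] -/
theorem k2r_ref_weight0 {R : ℝ} (hR : 0 < R) :
    Measurable (fun v : EuclideanSpace ℝ (Fin 3) => ((1 + ‖v‖ ^ 2) ^ 3)⁻¹ * Real.exp (-‖v‖ ^ 2 / R)) ∧
    Integrable (fun v : EuclideanSpace ℝ (Fin 3) => (1 + ‖v‖ ^ 2) ^ 2 * (((1 + ‖v‖ ^ 2) ^ 3)⁻¹ * Real.exp (-‖v‖ ^ 2 / R))) := by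
  refine ⟨by fun_prop, ?_⟩
  have hG : Integrable (fun v : EuclideanSpace ℝ (Fin 3) => Real.exp (-(1 / R) * ‖v‖ ^ 2)) :=
    integrable_exp_neg_mul_sq_norm (by positivity)
  refine hG.mono' (by fun_prop : Measurable fun v : EuclideanSpace ℝ (Fin 3) =>
      (1 + ‖v‖ ^ 2) ^ 2 * (((1 + ‖v‖ ^ 2) ^ 3)⁻¹ * Real.exp (-‖v‖ ^ 2 / R))).aestronglyMeasurable
    (Eventually.of_forall fun v => ?_)
  rw [Real.norm_of_nonneg (by positivity)]
  have h1 : (1 + ‖v‖ ^ 2) ^ 2 * ((1 + ‖v‖ ^ 2) ^ 3)⁻¹ ≤ 1 := by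
    rw [← div_eq_mul_inv, div_le_one (by positivity)]
    nlinarith [sq_nonneg ‖v‖, sq_nonneg (‖v‖ ^ 2)]
  calc (1 + ‖v‖ ^ 2) ^ 2 * (((1 + ‖v‖ ^ 2) ^ 3)⁻¹ * Real.exp (-‖v‖ ^ 2 / R))
      = ((1 + ‖v‖ ^ 2) ^ 2 * ((1 + ‖v‖ ^ 2) ^ 3)⁻¹) * Real.exp (-‖v‖ ^ 2 / R) := by ring
    _ ≤ 1 * Real.exp (-‖v‖ ^ 2 / R) := by gcongr
    _ = Real.exp (-(1 / R) * ‖v‖ ^ 2) := by rw [one_mul]; congr 1; ring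

/-- The dipole weight `Θ₁^R(v) = |v|(1+|v|²)⁻⁴e^{-|v|²/R} v₀` on `ℝ³`: measurable, with
`(1+|v|²)² |Θ₁^R| ≤ e^{-|v|²/R} ∈ L¹`. [folklore] -/
theorem k2r_ref_weight1 {R : ℝ} (hR : 0 < R) :
    Measurable (fun v : EuclideanSpace ℝ (Fin 3) =>
      Real.sqrt (‖v‖ ^ 2) * ((1 + ‖v‖ ^ 2) ^ 4)⁻¹ * Real.exp (-‖v‖ ^ 2 / R) * v 0) ∧
    Integrable (fun v : EuclideanSpace ℝ (Fin 3) => (1 + ‖v‖ ^ 2) ^ 2 *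
      (Real.sqrt (‖v‖ ^ 2) * ((1 + ‖v‖ ^ 2) ^ 4)⁻¹ * Real.exp (-‖v‖ ^ 2 / R) * v 0)) := by
  have hsm : Measurable Real.sqrt := Real.continuous_sqrt.measurable
  refine ⟨by fun_prop, ?_⟩
  have hG : Integrable (fun v : EuclideanSpace ℝ (Fin 3) => Real.exp (-(1 / R) * ‖v‖ ^ 2)) :=
    integrable_exp_neg_mul_sq_norm (by positivity)
  refine hG.mono' (by fun_prop : Measurable fun v : EuclideanSpace ℝ (Fin 3) => (1 + ‖v‖ ^ 2) ^ 2 *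
      (Real.sqrt (‖v‖ ^ 2) * ((1 + ‖v‖ ^ 2) ^ 4)⁻¹ * Real.exp (-‖v‖ ^ 2 / R) * v 0)).aestronglyMeasurable
    (Eventually.of_forall fun v => ?_)
  have hv0 : |v 0| ≤ ‖v‖ := by simpa [Real.norm_eq_abs] using PiLp.norm_apply_le v 0
  rw [Real.norm_eq_abs, Real.sqrt_sq (norm_nonneg v), abs_mul, abs_of_nonneg (by positivity),
    abs_mul, abs_of_nonneg (by positivity)]
  have h1 : (1 + ‖v‖ ^ 2) ^ 2 * (‖v‖ * ((1 + ‖v‖ ^ 2) ^ 4)⁻¹ * ‖v‖) ≤ 1 := by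
    rw [show (1 + ‖v‖ ^ 2) ^ 2 * (‖v‖ * ((1 + ‖v‖ ^ 2) ^ 4)⁻¹ * ‖v‖) =
      (1 + ‖v‖ ^ 2) ^ 2 * ‖v‖ ^ 2 / (1 + ‖v‖ ^ 2) ^ 4 by ring, div_le_one (by positivity)]
    nlinarith [sq_nonneg ‖v‖, sq_nonneg (‖v‖ ^ 2), sq_nonneg (‖v‖ ^ 3)]
  calc (1 + ‖v‖ ^ 2) ^ 2 * (‖v‖ * ((1 + ‖v‖ ^ 2) ^ 4)⁻¹ * Real.exp (-‖v‖ ^ 2 / R) * |v 0|)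
      ≤ (1 + ‖v‖ ^ 2) ^ 2 * (‖v‖ * ((1 + ‖v‖ ^ 2) ^ 4)⁻¹ * Real.exp (-‖v‖ ^ 2 / R) * ‖v‖) := by
        gcongr
    _ = (1 + ‖v‖ ^ 2) ^ 2 * (‖v‖ * ((1 + ‖v‖ ^ 2) ^ 4)⁻¹ * ‖v‖) * Real.exp (-‖v‖ ^ 2 / R) := by
        ring
    _ ≤ 1 * Real.exp (-‖v‖ ^ 2 / R) := by gcongr
    _ = Real.exp (-(1 / R) * ‖v‖ ^ 2) := by rw [one_mul]; congr 1; ring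

/-- **Transverse integral of the dipole weight over a fibre.** In adapted coordinates
`v = a e + ι y`: `∫_{ℝ²} ϑ₁^R(a² + |y|²) (a e₀ + (ι y)₀) dy = e₀ a · π Θ̄₁^R(a²)` — the odd part
`(ι y)₀` integrates to zero and the radial part is `k2r_ref_integral_radial_fin_two`. [folklore] -/
theorem k2r_ref_fibre_integral1 {R : ℝ} (hR : 0 < R) {e : EuclideanSpace ℝ (Fin 3)} (he : ‖e‖ = 1) (ι : EuclideanSpace ℝ (Fin 2) →ₗᵢ[ℝ] EuclideanSpace ℝ (Fin 3))
    (hιe : ∀ u, ⟪e, ι u⟫_ℝ = 0) (a : ℝ) :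
    ∫ y : EuclideanSpace ℝ (Fin 2), Real.sqrt (‖a • e + ι y‖ ^ 2) * ((1 + ‖a • e + ι y‖ ^ 2) ^ 4)⁻¹ *
        Real.exp (-‖a • e + ι y‖ ^ 2 / R) * (a • e + ι y) 0 =
      e 0 * a * (π * ∫ E in Ioi (a ^ 2), Real.sqrt E * ((1 + E) ^ 4)⁻¹ * Real.exp (-E / R)) := by
  set θ : ℝ → ℝ := fun E => Real.sqrt E * ((1 + E) ^ 4)⁻¹ * Real.exp (-E / R) with hθ
  have hcoord : ∀ y : EuclideanSpace ℝ (Fin 2), (a • e + ι y) 0 = a * e 0 + (ι y) 0 := fun y => by simp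
  simp_rw [k2r_ref_norm_sq_axis he ι hιe, hcoord]
  show ∫ y : EuclideanSpace ℝ (Fin 2), θ (a ^ 2 + ‖y‖ ^ 2) * (a * e 0 + (ι y) 0) = _
  -- domination on the fibre
  have hθb : ∀ y : EuclideanSpace ℝ (Fin 2), |θ (a ^ 2 + ‖y‖ ^ 2)| ≤ Real.exp (-(2 / R / 2) * ‖y‖ ^ 2) := by
    intro y
    have hX : 0 ≤ a ^ 2 + ‖y‖ ^ 2 := by positivity
    set X := a ^ 2 + ‖y‖ ^ 2 with hXdef
    have h1 : Real.sqrt X * ((1 + X) ^ 4)⁻¹ ≤ 1 := by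
      rw [← div_eq_mul_inv, div_le_one (by positivity)]
      calc Real.sqrt X ≤ 1 + X := by rw [Real.sqrt_le_left (by positivity)]; nlinarith
        _ ≤ (1 + X) ^ 4 := le_self_pow₀ (by linarith) (by norm_num)
    have h2 : Real.exp (-X / R) ≤ Real.exp (-(2 / R / 2) * ‖y‖ ^ 2) := by
      rw [Real.exp_le_exp, show -(2 / R / 2) * ‖y‖ ^ 2 = -‖y‖ ^ 2 / R by ring]
      rw [div_le_div_iff_of_pos_right hR]  -- -X ≤ -‖y‖^2
      nlinarith [sq_nonneg a]
    rw [hθ]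
    simp only
    rw [abs_of_nonneg (by positivity)]
    calc Real.sqrt X * ((1 + X) ^ 4)⁻¹ * Real.exp (-X / R) ≤ 1 * Real.exp (-(2 / R / 2) * ‖y‖ ^ 2) := by
          gcongr
      _ = _ := one_mul _
  have hG : Integrable (fun y : EuclideanSpace ℝ (Fin 2) => (1 + ‖y‖) * Real.exp (-(2 / R / 2) * ‖y‖ ^ 2)) :=
    integrable_one_add_norm_mul_exp (by positivity)
  have hsm : Measurable Real.sqrt := Real.continuous_sqrt.measurable
  have hιc : Continuous ι := ι.continuous
  have hθm : Measurable (fun y : EuclideanSpace ℝ (Fin 2) => θ (a ^ 2 + ‖y‖ ^ 2)) := by simp only [hθ]; fun_prop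
  have hι0 : ∀ y : EuclideanSpace ℝ (Fin 2), |(ι y) 0| ≤ ‖y‖ := fun y => by
    have h := PiLp.norm_apply_le (ι y) 0
    rw [Real.norm_eq_abs, ι.norm_map] at h
    exact h
  have hi1 : Integrable (fun y : EuclideanSpace ℝ (Fin 2) => θ (a ^ 2 + ‖y‖ ^ 2) * (a * e 0)) := by
    refine (hG.const_mul |a * e 0|).mono' (by fun_prop : Measurable fun y : EuclideanSpace ℝ (Fin 2) =>
        θ (a ^ 2 + ‖y‖ ^ 2) * (a * e 0)).aestronglyMeasurable (Eventually.of_forall fun y => ?_)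
    rw [Real.norm_eq_abs, abs_mul]
    calc |θ (a ^ 2 + ‖y‖ ^ 2)| * |a * e 0| ≤ Real.exp (-(2 / R / 2) * ‖y‖ ^ 2) * |a * e 0| := by
          gcongr; exact hθb y
      _ ≤ (1 + ‖y‖) * Real.exp (-(2 / R / 2) * ‖y‖ ^ 2) * |a * e 0| := by
          gcongr
          exact le_mul_of_one_le_left (Real.exp_pos _).le (by linarith [norm_nonneg y])
      _ = |a * e 0| * ((1 + ‖y‖) * Real.exp (-(2 / R / 2) * ‖y‖ ^ 2)) := by ring
  have hi2 : Integrable (fun y : EuclideanSpace ℝ (Fin 2) => θ (a ^ 2 + ‖y‖ ^ 2) * (ι y) 0) := by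
    refine hG.mono' (by fun_prop : Measurable fun y : EuclideanSpace ℝ (Fin 2) =>
        θ (a ^ 2 + ‖y‖ ^ 2) * (ι y) 0).aestronglyMeasurable (Eventually.of_forall fun y => ?_)
    rw [Real.norm_eq_abs, abs_mul]
    calc |θ (a ^ 2 + ‖y‖ ^ 2)| * |(ι y) 0| ≤ Real.exp (-(2 / R / 2) * ‖y‖ ^ 2) * ‖y‖ := by
          gcongr; exact hθb y; exact hι0 y
      _ ≤ (1 + ‖y‖) * Real.exp (-(2 / R / 2) * ‖y‖ ^ 2) := by
          nlinarith [Real.exp_pos (-(2 / R / 2) * ‖y‖ ^ 2), norm_nonneg y]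
  -- the odd part vanishes
  have hodd : ∫ y : EuclideanSpace ℝ (Fin 2), θ (a ^ 2 + ‖y‖ ^ 2) * (ι y) 0 = 0 := by
    have h := integral_neg_eq_self (fun y : EuclideanSpace ℝ (Fin 2) => θ (a ^ 2 + ‖y‖ ^ 2) * (ι y) 0) volume
    simp only [norm_neg, map_neg] at h
    have h' : ∫ y : EuclideanSpace ℝ (Fin 2), θ (a ^ 2 + ‖y‖ ^ 2) * (-(ι y)) 0 = -∫ y : EuclideanSpace ℝ (Fin 2), θ (a ^ 2 + ‖y‖ ^ 2) * (ι y) 0 := by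
      rw [← integral_neg]
      refine integral_congr_ae (Eventually.of_forall fun y => ?_)
      simp only [WithLp.ofLp_neg, Pi.neg_apply]
      ring
    linarith
  calc ∫ y : EuclideanSpace ℝ (Fin 2), θ (a ^ 2 + ‖y‖ ^ 2) * (a * e 0 + (ι y) 0)
      = ∫ y : EuclideanSpace ℝ (Fin 2), (θ (a ^ 2 + ‖y‖ ^ 2) * (a * e 0) + θ (a ^ 2 + ‖y‖ ^ 2) * (ι y) 0) := by
        simp_rw [mul_add]
    _ = (∫ y : EuclideanSpace ℝ (Fin 2), θ (a ^ 2 + ‖y‖ ^ 2) * (a * e 0)) + ∫ y : EuclideanSpace ℝ (Fin 2), θ (a ^ 2 + ‖y‖ ^ 2) * (ι y) 0 :=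
        integral_add hi1 hi2
    _ = (∫ y : EuclideanSpace ℝ (Fin 2), θ (a ^ 2 + ‖y‖ ^ 2)) * (a * e 0) := by rw [integral_mul_const, hodd, add_zero]
    _ = e 0 * a * (π * ∫ E in Ioi (a ^ 2), θ E) := by
        rw [k2r_ref_integral_radial_fin_two θ (a ^ 2)]; ring

/-! ## The registered stub -/

/-- **Pre/post-collisional duality per impact direction (the swap formula), stub `dualitySlice` of
the refutation line of crux `AdjointEnskogTestFamilyR`.** For `R ≥ 1`, a unit impact direction
`ν`, a measurable `F` with `|F(U)| ≤ C_F(1+|U|²)` and the weights `Θ₀^R(v) = (1+|v|²)⁻³e^{-|v|²/R}`,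
`Θ₁^R(v) = |v|(1+|v|²)⁻⁴e^{-|v|²/R} v₀`:
`∫ Θ(v) ∫ ((v-w)·ν)₊ M(w) F(w') dw dv = ∫ F(U) I[Θ](U,ν) dU`, `w' = (collide ν (v,w)).2`, with
`I₀(U,ν) = ½ e^{-(|U|²-a²)/2} h(a) Θ̄₀(a²)`, `I₁(U,ν) = ν₀ a · ½ e^{-(|U|²-a²)/2} h(a) Θ̄₁(a²)`,
`a = U·ν`, `h(a) = ∫ (a-b)₊φ₁`, `Θ̄(x) = ∫_x^∞ ϑ`, together with the integrability of all
integrands and the bounds `0 ≤ I₀ ≤ (1+|a|)e^{-(|U|²-a²)/2}`, `|I₁| ≤ (1+|a|)²e^{-(|U|²-a²)/2}`.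
[cite: CIP1994, §3.1 (1.7)–(1.9)] -/
theorem stub_dualitySlice :
  let φ₁ : ℝ → ℝ := fun b => Real.exp (-b ^ 2 / 2) / Real.sqrt (2 * Real.pi)
  let h : ℝ → ℝ := fun a => ∫ b, max (a - b) 0 * φ₁ b
  let th0 : ℝ → ℝ → ℝ := fun R E => ((1 + E) ^ 3)⁻¹ * Real.exp (-E / R)
  let th1 : ℝ → ℝ → ℝ := fun R E => Real.sqrt E * ((1 + E) ^ 4)⁻¹ * Real.exp (-E / R)
  let Tb0 : ℝ → ℝ → ℝ := fun R x => ∫ E in Set.Ioi x, th0 R E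
  let Tb1 : ℝ → ℝ → ℝ := fun R x => ∫ E in Set.Ioi x, th1 R E
  let I0 : ℝ → EuclideanSpace ℝ (Fin 3) → EuclideanSpace ℝ (Fin 3) → ℝ := fun R U n =>
    (1 / 2 : ℝ) * Real.exp (-(‖U‖ ^ 2 - inner ℝ U n ^ 2) / 2) * h (inner ℝ U n) * Tb0 R (inner ℝ U n ^ 2)
  let I1 : ℝ → EuclideanSpace ℝ (Fin 3) → EuclideanSpace ℝ (Fin 3) → ℝ := fun R U n =>
    n 0 * inner ℝ U n *
      ((1 / 2 : ℝ) * Real.exp (-(‖U‖ ^ 2 - inner ℝ U n ^ 2) / 2) * h (inner ℝ U n) * Tb1 R (inner ℝ U n ^ 2))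
  ∀ R : ℝ, 1 ≤ R → ∀ (ν : Metric.sphere (0 : EuclideanSpace ℝ (Fin 3)) 1)
    (F : EuclideanSpace ℝ (Fin 3) → ℝ), Measurable F → ∀ CF : ℝ, (∀ U, |F U| ≤ CF * (1 + ‖U‖ ^ 2)) →
    (Integrable (fun p : EuclideanSpace ℝ (Fin 3) × EuclideanSpace ℝ (Fin 3) =>
        th0 R (‖p.1‖ ^ 2) * (max (inner ℝ (p.1 - p.2) (ν : EuclideanSpace ℝ (Fin 3))) 0 * globalMaxwellian p.2 *
          F (collide ν p).2))) ∧
    (Integrable (fun U : EuclideanSpace ℝ (Fin 3) => F U * I0 R U ν)) ∧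
    (∫ v : EuclideanSpace ℝ (Fin 3), th0 R (‖v‖ ^ 2) * ∫ w : EuclideanSpace ℝ (Fin 3),
        max (inner ℝ (v - w) (ν : EuclideanSpace ℝ (Fin 3))) 0 * globalMaxwellian w * F (collide ν (v, w)).2)
      = ∫ U : EuclideanSpace ℝ (Fin 3), F U * I0 R U ν ∧
    (Integrable (fun p : EuclideanSpace ℝ (Fin 3) × EuclideanSpace ℝ (Fin 3) =>
        th1 R (‖p.1‖ ^ 2) * p.1 0 * (max (inner ℝ (p.1 - p.2) (ν : EuclideanSpace ℝ (Fin 3))) 0 *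
          globalMaxwellian p.2 * F (collide ν p).2))) ∧
    (Integrable (fun U : EuclideanSpace ℝ (Fin 3) => F U * I1 R U ν)) ∧
    (∫ v : EuclideanSpace ℝ (Fin 3), th1 R (‖v‖ ^ 2) * v 0 * ∫ w : EuclideanSpace ℝ (Fin 3),
        max (inner ℝ (v - w) (ν : EuclideanSpace ℝ (Fin 3))) 0 * globalMaxwellian w * F (collide ν (v, w)).2)
      = ∫ U : EuclideanSpace ℝ (Fin 3), F U * I1 R U ν ∧
    (∀ U, 0 ≤ I0 R U ν ∧ I0 R U ν ≤ (1 + |inner ℝ U ν|) * Real.exp (-(‖U‖ ^ 2 - inner ℝ U ν ^ 2) / 2) ∧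
      |I1 R U ν| ≤ (1 + |inner ℝ U ν|) ^ 2 * Real.exp (-(‖U‖ ^ 2 - inner ℝ U ν ^ 2) / 2)) := by
  intro φ₁ h th0 th1 Tb0 Tb1 I0 I1 R hR ν F hF CF hCF
  have hR0 : 0 < R := by linarith
  have he : ‖(ν : EuclideanSpace ℝ (Fin 3))‖ = 1 := norm_eq_of_mem_sphere ν
  have hn : Module.finrank ℝ (EuclideanSpace ℝ (Fin 3)) = 2 + 1 := finrank_euclideanSpace_fin
  obtain ⟨ι, hιe, hΦ⟩ := exists_axisDecomposition hn (ν : EuclideanSpace ℝ (Fin 3)) he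
  obtain ⟨h0m, h0i⟩ := k2r_ref_weight0 (R := R) hR0
  obtain ⟨h1m, h1i⟩ := k2r_ref_weight1 (R := R) hR0
  have hπ : (π : ℝ) ≠ 0 := Real.pi_ne_zero
  -- the radial weight
  have hA0 := k2r_ref_integrable_pair ν h0m h0i hF hCF
  obtain ⟨hI0, hE0⟩ := k2r_ref_duality ν ι hιe hΦ h0m h0i hF hCF (I := fun U => I0 R U ν) (fun U => by
    have hT := k2r_ref_integral_radial_fin_two (fun E => ((1 + E) ^ 3)⁻¹ * Real.exp (-E / R))
      (⟪U, (ν : EuclideanSpace ℝ (Fin 3))⟫_ℝ ^ 2)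
    simp only [I0, h, φ₁, Tb0, th0]
    simp_rw [k2r_ref_norm_sq_axis he ι hιe]
    rw [hT]
    field_simp)
  -- the dipole weight
  have hA1 := k2r_ref_integrable_pair ν h1m h1i hF hCF
  obtain ⟨hI1, hE1⟩ := k2r_ref_duality ν ι hιe hΦ h1m h1i hF hCF (I := fun U => I1 R U ν) (fun U => by
    simp only [I1, h, φ₁, Tb1, th1]
    rw [k2r_ref_fibre_integral1 hR0 he ι hιe]
    field_simp)
  refine ⟨hA0, hI0, hE0, ?_, hI1, ?_, fun U => ?_⟩
  · simpa only [th1, mul_assoc] using hA1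
  · simpa only [th1, mul_assoc] using hE1
  -- the crude kernel bounds
  set a : ℝ := ⟪U, (ν : EuclideanSpace ℝ (Fin 3))⟫_ℝ with ha
  have hh := k2r_ref_h_bounds a
  have hT0 := k2r_ref_tail_bounds (θ := fun E => ((1 + E) ^ 3)⁻¹ * Real.exp (-E / R))
    (fun E hE => k2r_ref_th0_bounds hR0 hE) (sq_nonneg a)
  have hT1 := k2r_ref_tail_bounds (θ := fun E => Real.sqrt E * ((1 + E) ^ 4)⁻¹ * Real.exp (-E / R))
    (fun E hE => k2r_ref_th1_bounds hR0 hE) (sq_nonneg a)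
  have hν0 : |(ν : EuclideanSpace ℝ (Fin 3)) 0| ≤ 1 := by
    have h := PiLp.norm_apply_le (ν : EuclideanSpace ℝ (Fin 3)) 0
    rw [Real.norm_eq_abs, he] at h
    exact h
  simp only [I0, I1, h, φ₁, Tb0, Tb1, th0, th1]
  set X := Real.exp (-(‖U‖ ^ 2 - a ^ 2) / 2) with hX
  have hXpos : 0 < X := Real.exp_pos _
  set hI := ∫ b, max (a - b) 0 * (Real.exp (-b ^ 2 / 2) / Real.sqrt (2 * π)) with hhI
  set T0 := ∫ E in Ioi (a ^ 2), ((1 + E) ^ 3)⁻¹ * Real.exp (-E / R) with hT0def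
  set T1 := ∫ E in Ioi (a ^ 2), Real.sqrt E * ((1 + E) ^ 4)⁻¹ * Real.exp (-E / R) with hT1def
  have hp0 : hI * T0 ≤ 2 * (1 + |a|) * (1 / 2) := mul_le_mul hh.2 hT0.2 hT0.1 (by positivity)
  have hp1 : hI * T1 ≤ 2 * (1 + |a|) * (1 / 2) := mul_le_mul hh.2 hT1.2 hT1.1 (by positivity)
  refine ⟨mul_nonneg (mul_nonneg (by positivity) hh.1) hT0.1, ?_, ?_⟩
  · calc 1 / 2 * X * hI * T0 = (1 / 2 * X) * (hI * T0) := by ring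
      _ ≤ (1 / 2 * X) * (2 * (1 + |a|) * (1 / 2)) := by gcongr
      _ ≤ (1 + |a|) * X := by nlinarith [abs_nonneg a]
  · rw [abs_mul, abs_mul, abs_of_nonneg (mul_nonneg (mul_nonneg (by positivity) hh.1) hT1.1 :
      (0 : ℝ) ≤ 1 / 2 * X * hI * T1)]
    calc |(ν : EuclideanSpace ℝ (Fin 3)) 0| * |a| * (1 / 2 * X * hI * T1) = |(ν : EuclideanSpace ℝ (Fin 3)) 0| * |a| * (1 / 2 * X) * (hI * T1) := by
          ring
      _ ≤ 1 * |a| * (1 / 2 * X) * (2 * (1 + |a|) * (1 / 2)) := by gcongr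
      _ ≤ (1 + |a|) ^ 2 * X := by nlinarith [abs_nonneg a, mul_nonneg (abs_nonneg a) hXpos.le]

end Summit.AtomisticToContinuum.HydrodynamicLimit.Theorems.EnskogAdjointDuality
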